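import Summits.QuantumFields.QCD.Theses.FourMirrorsWardE1
import Literature.MathematicalPhysics.QuantumFieldTheory.DiagonalLatticeClustering
import Literature.MathematicalPhysics.QuantumFieldTheory.OSReconstructionNoE1
import HarnessLib.Audit

/-!
# Birth skeleton (BC3) for crux `QCDModuloRotations` (item stmt-QuantumFields-17271) — `Lines/birth.lean`

Route `route-QuantumFields-FourMirrorsWardE1` (sub-problem QCD), crux decl
`Summit.QuantumFields.QCD.Theses.FourMirrorsWardE1.QCDModuloRotations` (rank 5, open-problem):
THE REST OF THE CONJUNCT — for `N_f = 2` and `N_f = 3`, one mass-independent regularisation `reg` with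
leading-log mass scaling and chiral at zero such that for every tuple of positive renormalised masses
there are species renormalisations `z, shift` and a labelled Schwinger family `S` with E0 (normalisation,
hermiticity), E0', TRANSLATION invariance, E2, E3, E4, which IS the sequential continuum limit of honest
lattice QCD along `reg.scheme m z shift` (asymptotic scaling, physical branch, convergence on off-diagonal
real tensors), has a mass gap `Δ > 0` of all species strings together with the uniform lattice gap at the
same couplings, and which — once the rotation half of E1 holds for `S` — packages into OS data `T`
(`T.schwinger = S`) with non-trivial, non-Gaussian `glue` and every flavour-changing pseudoscalar
non-trivial.  Exactly `QCDOf 2 ∧ QCDOf 3` with rotations excised (the route's `closes :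
RotationRestoration → QCDModuloRotations → QCD`).

Registered by the skeleton-registrar seat `planner-skel-stmt-QuantumFields-17271-0` (route re-audit bin
REPAIRABLE, 2026-08-17) as `Cruxes/QCDModuloRotations/Lines/birth.lean`.  LINE-NEUTRAL: the existential
conjunct is cut along the seam every existence route of this sub-problem already uses — LATTICE PACKAGE
(UV + IR, with the limit object) ⟹ OS CLOSURE MODULO ROTATIONS — and the closure half is cut exactly as
the registered birth skeleton of the sibling crux `GapBuysCauchyRate.ConvergentOSClosure`
(`Cruxes/ConvergentOSClosure/Lines/birth.lean`, stmt-QuantumFields-11525) cuts it, so that the three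
closure stubs below are VERBATIM the sibling's (S2)–(S4) and one proof serves both cruxes:

* `stub_latticePackage : LatticePackageStmt` — **THE HARD STUB (open-problem): the honest lattice limit
  with its UV package, the lattice gap, chirality and the species witnesses.**  For `N_f ∈ {2, 3}`: a
  regularisation `reg` with `HasMassScaling` and `IsChiralAtZero` such that for every positive mass tuple
  there are `z, shift` and a labelled family `S` that is NORMALISED (E0), of LINEAR GROWTH (E0'),
  SYMMETRIC (E3), TRANSLATION INVARIANT on `⁰𝒮`, IS the limit of the honest lattice `n`-point functions on
  off-diagonal real tensors along `reg.scheme m z shift` (two-loop asymptotic scaling, bare masses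
  eventually on the physical branch), with a uniform lattice gap `Δ > 0`, and whose `glue` two-point /
  three-point functions and flavour-changing `pseudoRe f g` two-point functions are connected-non-zero AT
  THE LEVEL OF `S` (unconditionally — the crux asks for them only after packaging; reviewer note R1 on the
  item, 2026-08-16).  Content: UV stability of 4D `SU(3)` with dynamical Wilson quarks (`k`-uniform
  Schwartz bounds `|S_k(n,σ,F)| ≤ α (n!)^β |F|_{ns}` ⇒ tempered extension, E0', translations by
  equicontinuity, E3 from Grassmann-even insertions), the volume-uniform lattice gap through the
  crossover, the chiral tuning of `m_crit`, non-decoupling.  What it deliberately does NOT contain: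
  E0-hermiticity, E2, E4 and the continuum gap `S.HasMassGap` — the IR closure below.
* `stub_reflectionAxioms : ReflectionAxiomsStmt` — **IR-soft: E0-hermiticity, E2, E4 of a lattice limit**
  (open, size L; = sibling (S2) verbatim).  For EVERY two-loop-AF lattice-QCD scheme with bare masses
  eventually on the physical branch and a uniform lattice gap, every normalised, linear-growth,
  translation-invariant labelled family that is the limit of its `n`-point functions on off-diagonal
  real tensors is hermitian, reflection positive and clustering.  Content: the own-torus functional
  (time-PERIODIC Wilson fermions: a `(−1)^F`-twisted trace, not configuration-wise RP) compared with a
  reflection-positive one with an error vanishing as `k → ∞` ("S → ∞ before k → ∞", bought from the gap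
  and `a_k L_k → ∞`); Θ-reality of the Wilson–Dirac functional (γ₅-hermiticity); E4 along spatial
  directions from the hypercubic images of the lattice gap.  Why it might fail: wrap-around errors carry
  `k`-dependent renormalisations; RP of the Wilson weight on odd tori needs `β_k ≥ 0` (eventually true
  under asymptotic scaling only for `N_f ≤ 16`; `N_f ≥ 17` is a junk regime of the hypotheses).
* `stub_speciesDiagClustering : SpeciesDiagClusteringStmt` — **IR-hard, lattice side: the gap in OS
  currency** (open, size L/XL; = sibling (S3) verbatim).  Along such a scheme, `HasLatticeMassGap Δ`
  (pairs of FIXED gauge-invariant local observables, pair-dependent constants and thresholds, all tori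
  `S ≥ L_k`) plus convergence of the species `n`-point functions upgrades to diagonal clustering AT THE
  SAME RATE `Δ` of the smeared renormalised species fields on the scheme's own tori,
  `sch.HasSpeciesDiagClustering Δ` (tree `DiagonalLatticeClustering`).  Content: Lüscher's positive
  transfer matrix for `r = 1` Wilson fermions at `m_f(k) > −1` (Montvay–Münster (4.111)), spectral
  reading of the all-pairs gap on the full physical space, `⟨v_k, T_k^{t/a_k} v_k⟩ ≤ ‖v_k‖² e^{−Δt}`.
  Why it might fail: pair-dependent thresholds vs the `k`-growing family of smeared products; thermal
  wrap-around on the time-periodic own torus.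
* `stub_gapTransfer : GapTransferStmt` — **continuum side of the gap transfer WITHOUT E1** (provable now,
  size M/L; = sibling (S4) verbatim): a normalised, translation-invariant, reflection-positive, clustering
  labelled family that is the limit of the species `n`-point functions of a scheme with
  `HasSpeciesDiagClustering Δ` has `HasMassGap Δ` — the port of the tree theorem
  `OSData.hasMassGap_of_tendsto_of_diagBound` from `T : OSData` to `OSReconstructionNoE1` hypotheses
  (its proof never uses rotations, and this crux needs `S.HasMassGap Δ` BEFORE E1 is available).

`QCDModuloRotations_of : Registered.stub_latticePackage → Registered.stub_reflectionAxioms →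
Registered.stub_speciesDiagClustering → Registered.stub_gapTransfer → QCDModuloRotations` (hypotheses
keyed by the registered stub names through the `Registered.stub_*` aliases, conclusion the route decl BY
NAME) is kernel-checked, no `sorry`: for `N_f ∈ {2,3}` the package gives `reg`, and per mass tuple
`z, shift, S` with E0/E0'/E3/translations/limit/lattice gap `Δ`; the IR-soft stub gives
E0-hermiticity/E2/E4; the lattice gap `Δ` ⇒ species diagonal clustering at `Δ` ⇒ `S.HasMassGap Δ` — the
SAME `Δ` as the lattice gap, as the crux demands; given proper rotations, `OSAxiomsSchwinger S` is
assembled and `OSData.ofAxioms` packages `S` with `T.schwinger = S` by `rfl`, the three species clauses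
holding definitionally from their `S`-level forms.  `QCDModuloRotations_proof` instantiates it with the
four stubs.

## Negative knowledge honoured
* `ledger crux ls stmt-QuantumFields-17271`: no `Disproof.lean`, no prior lines (2026-08-17).
* `ledger negatives --problem QuantumFields` (5 entries, 2026-08-17: RobustYangMillsRG 14958,
  MirrorModularBoosts.DiagonalMirrorRP 9665, AdaptiveCoarseSystem 9494, MultibosonLatticeGap 9599,
  AdmissibleRootsExist 9603): none is a lattice package / OS closure / gap transfer; 9599's refuted clause
  is the multiboson admissibility `Adm` (a monic-polynomial obstruction), absent here; no stub uses
  diagonal mirrors (9665) — rotations stay a HYPOTHESIS of the packaging clause, never derived.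
* Reviewer evidence on the item (rreview1, 2026-08-16): sandwich `QCD → QCDModuloRotations` and `closes`
  kernel-checked; R1 (species clauses conditional on the rotation premise — "state unconditionally"):
  the package stub states them unconditionally at the `S` level; R2 (`N_f` guard): every stub quantified
  over schemes keeps the crux's own hypothesis block, the package stub keeps `N_f ∈ {2,3}`.

## BC3 probes (registrar folder `bc/birth_probe_<Stmt>_<target>.lean`)
For each of the four stub statements `X`, `example : X → QCDModuloRotations` and `example : X → QCD` by
`first | exact? | simpa [X] | (unfold X; simpa) | aesop` (maxHeartbeats 400000) FAIL — outputs in the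
registrar's NOTES.md and in `Lines/birth.md`.
-/

noncomputable section

namespace Summit.QuantumFields.QCD.Cruxes.QCDModuloRotations.Birth

open scoped BigOperators Topology Classical SchwartzMap
open MeasureTheory Filter
open Literature.MathematicalPhysics.AQFT Literature.MathematicalPhysics.QuantumLattice
  Literature.MathematicalPhysics.QuantumFieldTheory
open Summit.QuantumFields.QCD.Theses.FourMirrorsWardE1 (QCDModuloRotations)

local notation "𝔼" => EuclideanSpace ℝ (Fin 4)

/-! ## §0 Currency: the recurring clauses of the crux, verbatim -/

/-- **Convergence on off-diagonal real tensors, ∃-limit form**: every lattice `n`-point function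
(`n ≥ 1`) of the scheme converges along the full sequence whenever the real test functions admit an
off-diagonal tensor (the hypothesis currency of the sibling skeleton's lattice-side stub). -/
def ConvergesOffDiag {Nf : ℕ} (sch : QCDScheme Nf) : Prop :=
  ∀ n : ℕ, n ≠ 0 → ∀ (σ : Fin n → QCDField Nf) (f : Fin n → 𝓢(𝔼, ℝ)) (F : 𝓢((Fin n → 𝔼), ℂ)),
    IsTensorOf F (fun i => ofRealTest (f i)) → IsOffDiagonal F →
      ∃ c : ℂ, Tendsto (fun k : ℕ => qcdLatticeSchwinger sch k n σ f) atTop (𝓝 c)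

/-- **`S` IS the limit on off-diagonal real tensors** (the convergence clause of the crux, verbatim;
literally the third clause of `IsQCDAlong sch T` with `S` for `T.schwinger`). -/
def IsLatticeLimit {Nf : ℕ} (sch : QCDScheme Nf) (S : LabelledSchwingerFamily (QCDField Nf) 𝔼) : Prop :=
  ∀ n : ℕ, n ≠ 0 → ∀ (σ : Fin n → QCDField Nf) (f : Fin n → 𝓢(𝔼, ℝ)) (F : 𝓢((Fin n → 𝔼), ℂ)),
    IsTensorOf F (fun i => ofRealTest (f i)) → IsOffDiagonal F →
      Tendsto (fun k : ℕ => qcdLatticeSchwinger sch k n σ f) atTop (𝓝 (S n σ F))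

/-- A lattice limit converges (the ∃-limit currency from the `S`-currency). [folklore] -/
theorem IsLatticeLimit.convergesOffDiag {Nf : ℕ} {sch : QCDScheme Nf}
    {S : LabelledSchwingerFamily (QCDField Nf) 𝔼} (h : IsLatticeLimit sch S) : ConvergesOffDiag sch :=
  fun n hn σ f F hF hoff => ⟨S n σ F, h n hn σ f F hF hoff⟩

/-- **Species `s` is not a c-number, at the level of the labelled family `S`**: the truncated
two-point function of `φ_s` does not vanish at some pair of time-separated arguments — the body of
`OSData.IsNontrivial` with `S` for `T.schwinger` (so that it IS `(OSData.ofAxioms S h).IsNontrivial s`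
definitionally). -/
def SpeciesNontrivial {ι : Type} (S : LabelledSchwingerFamily ι 𝔼) (s : ι) : Prop :=
  ∃ (F G : 𝓢((Fin 1 → 𝔼), ℂ)) (H : 𝓢((Fin (1 + 1) → 𝔼), ℂ)),
    IsTimeOrdered F ∧ IsTimeOrdered G ∧ IsAppendTensorOf H (osAdjoint F) G ∧
      S (1 + 1) (fun _ => s) H ≠ S 1 (fun _ => s) (osAdjoint F) * S 1 (fun _ => s) G

/-- **Species `s` is not a generalised free field, at the level of `S`**: some connected three-point
function on `⁰𝒮` is non-zero — the body of `OSData.IsNonGaussian` with `S` for `T.schwinger`. -/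
def SpeciesNonGaussian {ι : Type} (S : LabelledSchwingerFamily ι 𝔼) (s : ι) : Prop :=
  ∃ (f g h : 𝓢(𝔼, ℂ)) (Ffgh : 𝓢((Fin 3 → 𝔼), ℂ)) (Fgh Ffh Ffg : 𝓢((Fin 2 → 𝔼), ℂ))
    (Ff Fg Fh : 𝓢((Fin 1 → 𝔼), ℂ)),
    IsTensorOf Ffgh ![f, g, h] ∧ IsOffDiagonal Ffgh ∧
    IsTensorOf Fgh ![g, h] ∧ IsTensorOf Ffh ![f, h] ∧ IsTensorOf Ffg ![f, g] ∧
    IsTensorOf Ff ![f] ∧ IsTensorOf Fg ![g] ∧ IsTensorOf Fh ![h] ∧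
      S 3 (fun _ => s) Ffgh - S 1 (fun _ => s) Ff * S 2 (fun _ => s) Fgh -
          S 1 (fun _ => s) Fg * S 2 (fun _ => s) Ffh - S 1 (fun _ => s) Fh * S 2 (fun _ => s) Ffg +
        2 * (S 1 (fun _ => s) Ff * S 1 (fun _ => s) Fg * S 1 (fun _ => s) Fh) ≠ 0

/-! ## §1 The four stub statements -/

/-- **(S1) The honest lattice limit and its package — UV + IR existence, THE hard stub.**  For
`N_f = 2` and `N_f = 3`: one mass-independent regularisation `reg` with leading-log `HasMassScaling` and
`IsChiralAtZero` such that for every positive mass tuple `m` there are species renormalisations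
`z, shift` and a labelled Schwinger family `S` which is normalised (E0), of linear growth (E0'),
symmetric (E3) and translation invariant on `⁰𝒮`, IS the `k → ∞` limit of the honest lattice QCD
`n`-point functions along `reg.scheme m z shift` on off-diagonal real tensors (two-loop asymptotic
scaling, bare Wilson masses eventually on the physical branch), comes with a uniform lattice mass gap
`Δ > 0` at the same couplings, and has non-trivial and non-Gaussian `glue` and non-trivial
flavour-changing pseudoscalars `pseudoRe f g` (`f ≠ g`) at the level of `S`.  Open-problem: UV
stability of 4D `SU(3)` with dynamical Wilson quarks, the volume-uniform lattice gap through the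
crossover, the chiral tuning of `m_crit`, non-decoupling. -/
def LatticePackageStmt : Prop :=
  ∀ Nf : ℕ, (Nf = 2 ∨ Nf = 3) → ∃ reg : QCDRegularisation Nf, reg.HasMassScaling ∧ reg.IsChiralAtZero ∧
    ∀ m : Fin Nf → ℝ, (∀ f, 0 < m f) →
      ∃ (z shift : QCDField Nf → ℕ → ℝ) (S : LabelledSchwingerFamily (QCDField Nf) 𝔼),
        S.IsNormalized ∧ S.HasLinearGrowth ∧ S.IsSymmetric ∧ S.IsTranslationInvariant ∧
        (reg.scheme m z shift).HasAsymptoticScaling ∧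
        (∀ fl : Fin Nf, ∀ᶠ k in atTop, -1 < (reg.scheme m z shift).mq fl k) ∧
        IsLatticeLimit (reg.scheme m z shift) S ∧
        (∃ Δ > 0, (reg.scheme m z shift).HasLatticeMassGap Δ) ∧
        SpeciesNontrivial S QCDField.glue ∧ SpeciesNonGaussian S QCDField.glue ∧
        ∀ f g : Fin Nf, f ≠ g → SpeciesNontrivial S (QCDField.pseudoRe f g)

/-- **(S2) E0-hermiticity, E2 and E4 of the limit — IR-soft** (verbatim the sibling skeleton's
`ReflectionAxiomsStmt`, `Cruxes/ConvergentOSClosure/Lines/birth.lean`).  For every two-loop-AF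
lattice-QCD scheme with bare masses eventually on the physical branch and a uniform lattice gap, every
normalised, linear-growth, translation-invariant labelled family that is the limit of its `n`-point
functions on off-diagonal real tensors is hermitian, reflection positive and has the cluster property.
Open (`S → ∞` before `k → ∞` for the time-periodic own-torus functional). -/
def ReflectionAxiomsStmt : Prop :=
  ∀ (Nf : ℕ) (sch : QCDScheme Nf), sch.HasAsymptoticScaling →
    (∀ fl : Fin Nf, ∀ᶠ k in atTop, -1 < sch.mq fl k) → (∃ Δ > 0, sch.HasLatticeMassGap Δ) →
    ∀ S : LabelledSchwingerFamily (QCDField Nf) 𝔼, S.IsNormalized → S.HasLinearGrowth →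
      S.IsTranslationInvariant → IsLatticeLimit sch S →
        S.IsHermitian ∧ S.IsReflectionPositive ∧ S.HasClusterProperty

/-- **(S3) The lattice gap in OS currency — IR-hard, lattice side** (verbatim the sibling skeleton's
`SpeciesDiagClusteringStmt`).  Along a two-loop-AF scheme with bare masses eventually on the physical
branch whose species `n`-point functions converge on off-diagonal real tensors, the uniform lattice gap
`HasLatticeMassGap Δ` (`0 < Δ`) gives diagonal clustering AT THE SAME RATE `Δ` of the smeared
renormalised species fields on the scheme's own tori, `sch.HasSpeciesDiagClustering Δ`.  Open
(pair-dependent thresholds; thermal wrap-around). -/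
def SpeciesDiagClusteringStmt : Prop :=
  ∀ (Nf : ℕ) (sch : QCDScheme Nf) (Δ : ℝ), 0 < Δ → sch.HasAsymptoticScaling →
    (∀ fl : Fin Nf, ∀ᶠ k in atTop, -1 < sch.mq fl k) → sch.HasLatticeMassGap Δ →
    ConvergesOffDiag sch → sch.HasSpeciesDiagClustering Δ

/-- **(S4) Gap transfer to a labelled limit without E1 — continuum side, provable now** (verbatim the
sibling skeleton's `GapTransferStmt`).  A normalised, translation-invariant, reflection-positive,
clustering labelled family that is the limit of the species `n`-point functions of a scheme with
`HasSpeciesDiagClustering Δ` has `HasMassGap Δ` (port of `OSData.hasMassGap_of_tendsto_of_diagBound` to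
`OSReconstructionNoE1` hypotheses). -/
def GapTransferStmt : Prop :=
  ∀ (Nf : ℕ) (sch : QCDScheme Nf) (Δ : ℝ) (S : LabelledSchwingerFamily (QCDField Nf) 𝔼),
    S.IsNormalized → S.IsTranslationInvariant → S.IsReflectionPositive → S.HasClusterProperty →
    IsLatticeLimit sch S → sch.HasSpeciesDiagClustering Δ → S.HasMassGap Δ

/-! ## §2 The registered stubs (the ONLY `sorry`s of this file) -/

/-- (S1) the honest lattice limit and its package — THE hard stub, open-problem. -/
theorem stub_latticePackage : LatticePackageStmt := by
  sorry

/-- (S2) E0-hermiticity, E2, E4 of the limit — open, size L. -/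
theorem stub_reflectionAxioms : ReflectionAxiomsStmt := by
  sorry

/-- (S3) the lattice gap in OS currency (species diagonal clustering at the lattice rate) — open, size L/XL. -/
theorem stub_speciesDiagClustering : SpeciesDiagClusteringStmt := by
  sorry

/-- (S4) gap transfer to a labelled limit without E1 — provable now, size M/L. -/
theorem stub_gapTransfer : GapTransferStmt := by
  sorry

/-! ### Name-keyed aliases of the four statements (hypotheses of the composition)

`Registered.stub_X` is statement `X` under the registered stub's short name, so that the native skeleton
audit (hypotheses admissible iff registered obligations / declared stubs BY NAME) accepts
`QCDModuloRotations_of` whichever candidate it inspects (device of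
`Cruxes/RotationRestoration/Lines/birth.lean`). -/
namespace Registered

/-- Alias of `LatticePackageStmt` keyed by the registered stub name. -/
abbrev stub_latticePackage : Prop := LatticePackageStmt
/-- Alias of `ReflectionAxiomsStmt` keyed by the registered stub name. -/
abbrev stub_reflectionAxioms : Prop := ReflectionAxiomsStmt
/-- Alias of `SpeciesDiagClusteringStmt` keyed by the registered stub name. -/
abbrev stub_speciesDiagClustering : Prop := SpeciesDiagClusteringStmt
/-- Alias of `GapTransferStmt` keyed by the registered stub name. -/
abbrev stub_gapTransfer : Prop := GapTransferStmt

end Registered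

/-! ## §3 Composition (kernel-checked; no `sorry` below this line) -/

/-- **The crux from the four stubs** (concludes `FourMirrorsWardE1.QCDModuloRotations` BY NAME).  For
`N_f ∈ {2, 3}` the package stub gives `reg` (mass scaling, chiral at zero) and, per positive mass tuple,
`z, shift, S` with E0, E0', E3, translations, the convergence-to-`S` clause, asymptotic scaling, the
physical branch and the lattice gap `Δ > 0`; the IR-soft stub gives E0-hermiticity, E2, E4; the lattice
gap `Δ` ⇒ species diagonal clustering at `Δ` (IR-hard stub) ⇒ `S.HasMassGap Δ` (transfer stub), the
SAME `Δ`; given proper rotations on `⁰𝒮`, `OSAxiomsSchwinger S` is assembled from the pieces and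
`OSData.ofAxioms S _` is the package, with `T.schwinger = S` by `rfl` and the species clauses
definitionally the `S`-level ones. -/
theorem QCDModuloRotations_of (hPk : Registered.stub_latticePackage)
    (hIR : Registered.stub_reflectionAxioms) (hLat : Registered.stub_speciesDiagClustering)
    (hTrans : Registered.stub_gapTransfer) : QCDModuloRotations := by
  intro Nf hNf
  obtain ⟨reg, hScal, hChi, hAll⟩ := hPk Nf hNf
  refine ⟨reg, hScal, hChi, fun m hm => ?_⟩
  obtain ⟨z, shift, S, hN, hLG, hSy, hTr, hAS, hbr, hLim, ⟨Δ, hΔ, hGapL⟩, hNT, hNG, hND⟩ := hAll m hm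
  -- (2) IR-soft: hermiticity, reflection positivity, cluster property of the limit
  obtain ⟨hH, hRP, hCl⟩ :=
    hIR Nf (reg.scheme m z shift) hAS hbr ⟨Δ, hΔ, hGapL⟩ S hN hLG hTr hLim
  -- (3) IR-hard + transfer: the species gap at the lattice rate `Δ`
  have hDiag : (reg.scheme m z shift).HasSpeciesDiagClustering Δ :=
    hLat Nf (reg.scheme m z shift) Δ hΔ hAS hbr hGapL hLim.convergesOffDiag
  have hGapS : S.HasMassGap Δ := hTrans Nf (reg.scheme m z shift) Δ S hN hTr hRP hCl hLim hDiag
  -- (4) the matrix of the crux, with the rotation-conditional packaging clause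
  refine ⟨z, shift, S, hN, hH, hLG, hTr, hRP, hSy, hCl, hAS, hbr, hLim, ⟨Δ, hΔ, hGapS, hGapL⟩,
    fun hRot => ?_⟩
  have hOS : OSAxiomsSchwinger S :=
    { normalized := hN
      hermitian := hH
      invariant := ⟨hTr, hRot⟩
      reflectionPositive := hRP
      symmetric := hSy
      cluster := hCl
      linearGrowth := hLG }
  exact ⟨OSData.ofAxioms S hOS, rfl, hNT, hNG, hND⟩

/-- **The skeleton** (the hypothesis-free `<Crux>_proof` the skeleton check reads; its `sorry`-cone is
exactly the four registered stubs): the crux along this line. -/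
theorem QCDModuloRotations_proof : QCDModuloRotations :=
  QCDModuloRotations_of stub_latticePackage stub_reflectionAxioms stub_speciesDiagClustering
    stub_gapTransfer

end Summit.QuantumFields.QCD.Cruxes.QCDModuloRotations.Birth

end
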